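import Summits.ValiantsHypothesis.ValiantsHypothesis.Theorems.LacunarySymmetroidMatrixDescartesCensusDoorA34RootType
import Summits.ValiantsHypothesis.ValiantsHypothesis.Theorems.LacunarySymmetroidMatrixDescartesCensusDoorA34FlagLaw

/-!
# `MatrixDescartes` census — DOOR A at `(3,4)`: the ISOTROPIC FRAME of the INDEFINITE null-top cell — root TYPES are read off a
# `d₃`-FREE `(2,3)` minor, roots avoid the zone where the two free minors disagree in sign, and the type changes AT MOST FIVE times
# along the roots (nine on the full sheet, …CensusDoorA34RootType)

HONEST FRAMING.  Object-search cell `pub-symmetroid`, engine seat `val-sym-eng-2` (g6); helper rows beside the registered strata line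
`Cruxes/DoorA34/Lines/strata.lean` on stmt-ValiantsHypothesis-19980 (`DoorA34 = PosRootLawAt 3 4 18`: OPEN, typed, never asserted here), stub
`stub_nullTopCeiling` (`det S₃ = 0 ⇒ ≤ 17`).  The seat's atlas (HOME/DOOR-A34-ENG2G5-REPORT.md) shows that on the INDEFINITE cell (top letter of
rank two, indefinite — the cell of every null-top seventeen of record) NO coefficient-sign law acts; what is left there is root-level.  This file
records the first root-level rows of that cell that need no definite letter and no sign hypothesis.  An indefinite rank-two `S₃` is congruent to the
HYPERBOLIC normal form `h·(E₀₁ + E₁₀)` (`!![0, h, 0; h, 0, 0; 0, 0, 0]`; congruence rescales `det` by `det P²`, …EqualDiagonalChartRows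
`card_posRoots_congr`), whose principal `2 × 2` submatrices avoiding the index `0` and avoiding the index `1` VANISH: the coordinate planes `⟨e₁,e₂⟩`,
`⟨e₀,e₂⟩` are totally isotropic for `S₃`.  Consequences, for the pencil `F = Σ_l X^{d_l} S_l` with such a top letter (ANY support, ANY lower letters):

* `adjugate_two_minor_01/02/12` — Jacobi: `adjᵢᵢ·adjⱼⱼ − adjᵢⱼ·adjⱼᵢ = M_kk · det M` (any `3 × 3`, any commutative ring);
  `adjugate_diag_mul_diag_nonneg_of_det_eq_zero` — for a SINGULAR symmetric real `3 × 3` matrix all diagonal adjugate entries have pairwise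
  non-negative products, so (`trace_adjugate_pos_of_adjugate_diag_pos` / `…_neg_of_…_neg`) ANY non-zero diagonal adjugate entry carries the sign of
  `tr adj M` — the cell's ROOT TYPE (`+` semidefinite / conjugate line pair, `−` indefinite / real line pair; …RootRank, …RootType).
* **`adjugate_pencil_00_eq_isoMinor` / `…_11_…`** — in the hyperbolic normal form the diagonal adjugate entries `(adj F) 0 0`, `(adj F) 1 1` of the
  PENCIL are the determinants of `2 × 2` THREE-letter pencils (the `{1,2}`- and `{0,2}`-principal submatrices of `S₀, S₁, S₂` only): polynomials on
  the six pair sums of `d₀, d₁, d₂` (`card_support_isoMinor_le` via …FlagLaw `card_pairSums_three_le`, `signVariations_isoMinor_le` : `≤ 5`), in which NEITHER `d₃` NOR `S₃` OCCURS.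
* **`isoMinors_mul_nonneg_at_root`** — ROOT-FREE ZONE: at every real root `r` of `det F`, `(adj F(r)) 0 0 · (adj F(r)) 1 1 ≥ 0`: no root lies
  where the two free minors have opposite strict signs.
* **`type_pos_iff_isoMinor_pos`** — at a root where the free minor `(adj F(r)) 0 0` is non-zero, the type `tr adj F(r)` has its sign.
* **`sgnChanges_isoMinor_le_five`** — TYPE-CHANGE LAW: along ANY strictly increasing list of positive reals at which the free minor is non-zero
  (in particular along the det-roots of a hypothetical null-top eighteen), its sign changes at most `5` times (Descartes along points for a
  six-nomial, tree `sgnChanges_eval_le_signVariations`).  On the full sheet the type polynomial `tr adj F` lives on ten pair sums and the bound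
  is `9` (`sgnChanges_type_le_nine_of_nineteen`); on the indefinite null-top cell it drops to `5`: in inertia language, at most five of the
  consecutive root pairs of a null-top eighteen in this cell are monotone continuations `0→1→2`, `1→2→3` (or back), all others are turn-arounds.

LOCATED companion (seat report HOME/DOOR-A34-ENG2G6-REPORT.md §3, exact rational arithmetic): both null-top seventeens of record (p559152 on
`(0,1,4,359)`, p584238 on `(0,1,4,100)`) have ALL roots of middle type (inertia walk `2,1,2,1,…`, zero type changes, never definite) and both
free minors negative at every root.  Nothing here bounds any count; `DoorA34` and the three stubs stay OPEN; registers unchanged; nothing on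
`MatrixDescartes` (stmt-ValiantsHypothesis-18050) or `VP ≠ VNP` — VP≠VNP not moved.  [folklore] Jacobi's complementary-minor identity, Descartes' rule
along points; `ring` / `nlinarith`.
-/

-- `Summit.ValiantsHypothesis.ValiantsHypothesis.…` repeats a component by the D-0017 layout
-- (single-conjunct summit), which the `dupNamespace` linter flags; the name is mandated.
set_option linter.dupNamespace false

namespace Summit.ValiantsHypothesis.ValiantsHypothesis.Theorems.LacunarySymmetroidMatrixDescartes.Census

open Polynomial Finset
open scoped BigOperators Polynomial Matrix
open Summit.ValiantsHypothesis.ValiantsHypothesis.Theorems.KPlusLogSqLaw.WindowDescartes (sgnChanges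
  sgnChanges_eval_le_signVariations)

/-! ## 1. Jacobi's two-minor identities and the sign coherence of the diagonal of `adj M` on `{det M = 0}` -/

/-- Jacobi: `adj₀₀·adj₁₁ − adj₀₁·adj₁₀ = M₂₂·det M` (any `3 × 3` matrix over a commutative ring). [folklore] -/
theorem adjugate_two_minor_01 {R : Type*} [CommRing R] (M : Matrix (Fin 3) (Fin 3) R) :
    M.adjugate 0 0 * M.adjugate 1 1 - M.adjugate 0 1 * M.adjugate 1 0 = M 2 2 * M.det := by
  rw [Matrix.det_fin_three]
  simp [Matrix.adjugate_fin_three]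
  ring

/-- Jacobi: `adj₀₀·adj₂₂ − adj₀₂·adj₂₀ = M₁₁·det M`. [folklore] -/
theorem adjugate_two_minor_02 {R : Type*} [CommRing R] (M : Matrix (Fin 3) (Fin 3) R) :
    M.adjugate 0 0 * M.adjugate 2 2 - M.adjugate 0 2 * M.adjugate 2 0 = M 1 1 * M.det := by
  rw [Matrix.det_fin_three]
  simp [Matrix.adjugate_fin_three]
  ring

/-- Jacobi: `adj₁₁·adj₂₂ − adj₁₂·adj₂₁ = M₀₀·det M`. [folklore] -/
theorem adjugate_two_minor_12 {R : Type*} [CommRing R] (M : Matrix (Fin 3) (Fin 3) R) :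
    M.adjugate 1 1 * M.adjugate 2 2 - M.adjugate 1 2 * M.adjugate 2 1 = M 0 0 * M.det := by
  rw [Matrix.det_fin_three]
  simp [Matrix.adjugate_fin_three]
  ring

/-- **Sign coherence of the adjugate diagonal on the singular locus.**  For a real SYMMETRIC `3 × 3` matrix with `det M = 0` the diagonal
adjugate entries have pairwise non-negative products (`adjᵢᵢ·adjⱼⱼ = adjᵢⱼ²` by Jacobi and symmetry): they all carry the sign of `γ` in
`adj M = γ·kkᵀ`. [folklore] -/
theorem adjugate_diag_mul_diag_nonneg_of_det_eq_zero (M : Matrix (Fin 3) (Fin 3) ℝ) (hM : M.IsSymm) (h0 : M.det = 0) (i j : Fin 3) :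
    0 ≤ M.adjugate i i * M.adjugate j j := by
  have hA : M.adjugate.IsSymm := isSymm_adjugate_of_isSymm hM
  have hs : ∀ a b : Fin 3, M.adjugate b a = M.adjugate a b := fun a b => by
    have := congrFun (congrFun hA a) b
    simpa [Matrix.transpose_apply] using this
  have k01 := adjugate_two_minor_01 M
  have k02 := adjugate_two_minor_02 M
  have k12 := adjugate_two_minor_12 M
  rw [h0, mul_zero] at k01 k02 k12
  rw [hs 0 1] at k01
  rw [hs 0 2] at k02
  rw [hs 1 2] at k12
  have p01 : 0 ≤ M.adjugate 0 0 * M.adjugate 1 1 := by nlinarith [mul_self_nonneg (M.adjugate 0 1)]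
  have p02 : 0 ≤ M.adjugate 0 0 * M.adjugate 2 2 := by nlinarith [mul_self_nonneg (M.adjugate 0 2)]
  have p12 : 0 ≤ M.adjugate 1 1 * M.adjugate 2 2 := by nlinarith [mul_self_nonneg (M.adjugate 1 2)]
  -- all nine ordered pairs
  have key : ∀ a b : Fin 3, a ≤ b → 0 ≤ M.adjugate a a * M.adjugate b b := by
    intro a b hab
    fin_cases a <;> fin_cases b <;> simp only [Fin.isValue, Fin.zero_eta, Fin.mk_one] at hab ⊢
    all_goals first | exact mul_self_nonneg _ | exact p01 | exact p02 | exact p12 | exact absurd hab (by decide)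
  rcases le_total i j with hij | hji
  · exact key i j hij
  · rw [mul_comm]; exact key j i hji

/-- **A positive diagonal adjugate entry makes the type positive**: real symmetric, `det M = 0`, `0 < adjᵢᵢ` ⇒ `0 < tr adj M`. [folklore] -/
theorem trace_adjugate_pos_of_adjugate_diag_pos (M : Matrix (Fin 3) (Fin 3) ℝ) (hM : M.IsSymm) (h0 : M.det = 0) (i : Fin 3)
    (hi : 0 < M.adjugate i i) : 0 < M.adjugate.trace := by
  have hnn : ∀ j : Fin 3, 0 ≤ M.adjugate j j := fun j =>
    nonneg_of_mul_nonneg_right (adjugate_diag_mul_diag_nonneg_of_det_eq_zero M hM h0 i j) hi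
  unfold Matrix.trace Matrix.diag
  exact Finset.sum_pos' (fun j _ => hnn j) ⟨i, Finset.mem_univ _, hi⟩

/-- **A negative diagonal adjugate entry makes the type negative**: real symmetric, `det M = 0`, `adjᵢᵢ < 0` ⇒ `tr adj M < 0`. [folklore] -/
theorem trace_adjugate_neg_of_adjugate_diag_neg (M : Matrix (Fin 3) (Fin 3) ℝ) (hM : M.IsSymm) (h0 : M.det = 0) (i : Fin 3)
    (hi : M.adjugate i i < 0) : M.adjugate.trace < 0 := by
  have hnp : ∀ j : Fin 3, M.adjugate j j ≤ 0 := fun j => by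
    have h := adjugate_diag_mul_diag_nonneg_of_det_eq_zero M hM h0 i j
    rcases le_or_gt (M.adjugate j j) 0 with hj | hj
    · exact hj
    · exact absurd h (not_le.mpr (mul_neg_of_neg_of_pos hi hj))
  have hsum := Finset.sum_pos' (s := (Finset.univ : Finset (Fin 3))) (f := fun j => -M.adjugate j j)
    (fun j _ => by have := hnp j; linarith) ⟨i, Finset.mem_univ _, by linarith⟩
  simp only [Finset.sum_neg_distrib] at hsum
  unfold Matrix.trace Matrix.diag
  linarith

/-! ## 2. The two `d₃`-free minors of the hyperbolic normal form -/

/-- In the hyperbolic normal form the top letter's principal submatrix avoiding `0` vanishes. [folklore] -/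
theorem submatrix_succAbove_zero_hyperbolic (h : ℝ) :
    (!![0, h, 0; h, 0, 0; 0, 0, 0] : Matrix (Fin 3) (Fin 3) ℝ).submatrix (Fin.succAbove 0) (Fin.succAbove 0) = 0 := by
  ext i j
  fin_cases i <;> fin_cases j <;> rfl

/-- In the hyperbolic normal form the top letter's principal submatrix avoiding `1` vanishes. [folklore] -/
theorem submatrix_succAbove_one_hyperbolic (h : ℝ) :
    (!![0, h, 0; h, 0, 0; 0, 0, 0] : Matrix (Fin 3) (Fin 3) ℝ).submatrix (Fin.succAbove 1) (Fin.succAbove 1) = 0 := by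
  ext i j
  fin_cases i <;> fin_cases j <;> rfl

/-- **The free minor avoiding `i`**: if the top letter's principal submatrix avoiding `i` vanishes, the diagonal adjugate entry `(adj F) i i`
of the four-letter pencil is the determinant of the `2 × 2` pencil of the THREE lower letters' submatrices — `d₃` and `S₃` do not occur. [folklore] -/
theorem adjugate_pencil_diag_eq_threeLetter (d : Fin 4 → ℕ) (S : Fin 4 → Matrix (Fin 3) (Fin 3) ℝ) (i : Fin 3)
    (h3 : (S 3).submatrix (Fin.succAbove i) (Fin.succAbove i) = 0) :
    (∑ l, ((X : ℝ[X]) ^ d l) • (S l).map C).adjugate i i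
      = (∑ l : Fin 3, ((X : ℝ[X]) ^ d (Fin.castSucc l)) •
          ((S (Fin.castSucc l)).submatrix (Fin.succAbove i) (Fin.succAbove i)).map C).det := by
  rw [adjugate_pencil_diag_eq_det, Fin.sum_univ_castSucc]
  have hlast : ((X : ℝ[X]) ^ d (Fin.last 3)) • ((S (Fin.last 3)).submatrix (Fin.succAbove i) (Fin.succAbove i)).map C = 0 := by
    have : (Fin.last 3 : Fin 4) = 3 := rfl
    rw [this, h3]
    simp
  rw [hlast, add_zero]

/-- The free minor has at most `6` monomials (pair sums of `d₀, d₁, d₂`). [folklore] -/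
theorem card_support_isoMinor_le (d : Fin 4 → ℕ) (S : Fin 4 → Matrix (Fin 3) (Fin 3) ℝ) (i : Fin 3)
    (h3 : (S 3).submatrix (Fin.succAbove i) (Fin.succAbove i) = 0) :
    ((∑ l, ((X : ℝ[X]) ^ d l) • (S l).map C).adjugate i i).support.card ≤ 6 := by
  rw [adjugate_pencil_diag_eq_threeLetter d S i h3]
  have hsub := support_det_pencil_subset_sumset (fun l : Fin 3 => d (Fin.castSucc l))
    (fun l : Fin 3 => (S (Fin.castSucc l)).submatrix (Fin.succAbove i) (Fin.succAbove i))
  exact (Finset.card_le_card hsub).trans (card_pairSums_three_le (fun l : Fin 3 => d (Fin.castSucc l)))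

/-- … hence at most `5` sign variations. [folklore] -/
theorem signVariations_isoMinor_le (d : Fin 4 → ℕ) (S : Fin 4 → Matrix (Fin 3) (Fin 3) ℝ) (i : Fin 3)
    (h3 : (S 3).submatrix (Fin.succAbove i) (Fin.succAbove i) = 0) :
    ((∑ l, ((X : ℝ[X]) ^ d l) • (S l).map C).adjugate i i).signVariations ≤ 5 := by
  set g := (∑ l, ((X : ℝ[X]) ^ d l) • (S l).map C).adjugate i i with hg
  by_cases h0 : g = 0
  · rw [h0]; simp
  · have h1 := Literature.Computability.AlgebraicComplexity.signVariations_lt_card_support h0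
    have h2 := card_support_isoMinor_le d S i h3
    rw [← hg] at h2
    omega

/-- Evaluation of a diagonal adjugate entry of the pencil. [folklore] -/
theorem eval_adjugate_pencil_diag {K : ℕ} (d : Fin K → ℕ) (S : Fin K → Matrix (Fin 3) (Fin 3) ℝ) (i : Fin 3) (x : ℝ) :
    ((∑ l, ((X : ℝ[X]) ^ d l) • (S l).map C).adjugate i i).eval x = (∑ l, x ^ d l • S l).adjugate i i := by
  set M := (∑ l, ((X : ℝ[X]) ^ d l) • (S l).map C) with hM
  have h2 : M.adjugate.map (eval x) = (M.map (eval x)).adjugate := by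
    have := RingHom.map_adjugate (evalRingHom x) M
    simpa [RingHom.mapMatrix_apply, Polynomial.coe_evalRingHom] using this
  have h1 : (M.adjugate i i).eval x = (M.adjugate.map (eval x)) i i := by simp only [Matrix.map_apply]
  rw [h1, h2, hM, map_eval_pencil]

/-! ## 3. Root-level rows of the indefinite null-top cell -/

/-- **ROOT-FREE ZONE.**  For symmetric letters with the top letter in hyperbolic normal form, at every real root `r` of `det F` the two free
minors agree in sign: `0 ≤ (adj F(r)) 0 0 · (adj F(r)) 1 1` — no det-root lies where the `{1,2}`- and the `{0,2}`-three-letter `2 × 2`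
determinants have opposite strict signs. (Only symmetry and `det F(r) = 0` are used.) [folklore] -/
theorem isoMinors_mul_nonneg_at_root (d : Fin 4 → ℕ) (S : Fin 4 → Matrix (Fin 3) (Fin 3) ℝ) (hS : ∀ l, (S l).IsSymm)
    {r : ℝ} (hr : (Matrix.det (∑ l, ((X : ℝ[X]) ^ d l) • (S l).map C)).IsRoot r) :
    0 ≤ (∑ l, r ^ d l • S l).adjugate 0 0 * (∑ l, r ^ d l • S l).adjugate 1 1 := by
  have hdet : (∑ l, r ^ d l • S l).det = 0 := by
    have h := hr
    rw [Polynomial.IsRoot.def, ← Polynomial.coe_evalRingHom, RingHom.map_det, RingHom.mapMatrix_apply,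
      Polynomial.coe_evalRingHom, map_eval_pencil] at h
    exact h
  exact adjugate_diag_mul_diag_nonneg_of_det_eq_zero _ (isSymm_pencil_eval d hS r) hdet 0 1

/-- **THE TYPE IS THE SIGN OF THE FREE MINOR.**  Symmetric letters, `r` a real det-root with `(adj F(r)) i i ≠ 0`: the root type
`tr adj F(r)` is positive iff `(adj F(r)) i i` is positive (and negative iff negative). [folklore] -/
theorem type_pos_iff_adjugate_diag_pos (d : Fin 4 → ℕ) (S : Fin 4 → Matrix (Fin 3) (Fin 3) ℝ) (hS : ∀ l, (S l).IsSymm)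
    {r : ℝ} (hr : (Matrix.det (∑ l, ((X : ℝ[X]) ^ d l) • (S l).map C)).IsRoot r) (i : Fin 3)
    (hi : (∑ l, r ^ d l • S l).adjugate i i ≠ 0) :
    (0 < (∑ l, r ^ d l • S l).adjugate.trace ↔ 0 < (∑ l, r ^ d l • S l).adjugate i i) ∧
      ((∑ l, r ^ d l • S l).adjugate.trace < 0 ↔ (∑ l, r ^ d l • S l).adjugate i i < 0) := by
  have hdet : (∑ l, r ^ d l • S l).det = 0 := by
    have h := hr
    rw [Polynomial.IsRoot.def, ← Polynomial.coe_evalRingHom, RingHom.map_det, RingHom.mapMatrix_apply,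
      Polynomial.coe_evalRingHom, map_eval_pencil] at h
    exact h
  have hsym := isSymm_pencil_eval d hS r
  rcases lt_or_gt_of_ne hi with hneg | hpos
  · have ht := trace_adjugate_neg_of_adjugate_diag_neg _ hsym hdet i hneg
    exact ⟨⟨fun h => absurd h (not_lt.mpr ht.le), fun h => absurd h (not_lt.mpr hneg.le)⟩, ⟨fun _ => hneg, fun _ => ht⟩⟩
  · have ht := trace_adjugate_pos_of_adjugate_diag_pos _ hsym hdet i hpos
    exact ⟨⟨fun _ => hpos, fun _ => ht⟩, ⟨fun h => absurd h (not_lt.mpr ht.le), fun h => absurd h (not_lt.mpr hpos.le)⟩⟩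

/-- **TYPE-CHANGE LAW ON THE INDEFINITE NULL-TOP CELL (free minor avoiding `i`).**  If the top letter's principal submatrix avoiding `i`
vanishes (hyperbolic normal form: `i = 0` or `i = 1`), then along ANY strictly increasing list of positive reals at which the free minor
`(adj F(t)) i i` is non-zero, its sign changes at most `5` times.  At det-roots this sign IS the root type (`type_pos_iff_adjugate_diag_pos`), so
the types of the roots of a null-top pencil in the indefinite cell change at most five times (versus nine on the full sheet). [folklore] -/
theorem sgnChanges_isoMinor_le_five (d : Fin 4 → ℕ) (S : Fin 4 → Matrix (Fin 3) (Fin 3) ℝ) (i : Fin 3)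
    (h3 : (S 3).submatrix (Fin.succAbove i) (Fin.succAbove i) = 0)
    (xs : List ℝ) (hsort : xs.Pairwise (· < ·)) (hpos : ∀ x ∈ xs, 0 < x)
    (hne : ∀ x ∈ xs, (∑ l, x ^ d l • S l).adjugate i i ≠ 0) :
    sgnChanges (xs.map fun t => (∑ l, t ^ d l • S l).adjugate i i) ≤ 5 := by
  set g := (∑ l, ((X : ℝ[X]) ^ d l) • (S l).map C).adjugate i i with hg
  have hmap : (xs.map fun t => (∑ l, t ^ d l • S l).adjugate i i) = xs.map fun t => g.eval t := by
    refine List.map_congr_left fun t _ => ?_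
    rw [hg, eval_adjugate_pencil_diag]
  rw [hmap]
  have hne' : ∀ y ∈ xs, g.eval y ≠ 0 := fun y hy => by
    rw [hg, eval_adjugate_pencil_diag]; exact hne y hy
  exact (sgnChanges_eval_le_signVariations g xs hsort hpos hne').trans (signVariations_isoMinor_le d S i h3)

/-- **Packaged for the hyperbolic normal form `S 3 = !![0, h, 0; h, 0, 0; 0, 0, 0]`**: both free minors (avoiding `0` and avoiding `1`) obey the
type-change law, and at every det-root they agree in sign. [folklore] -/
theorem isoFrame_laws_of_hyperbolic (d : Fin 4 → ℕ) (S : Fin 4 → Matrix (Fin 3) (Fin 3) ℝ) (hS : ∀ l, (S l).IsSymm) (h : ℝ)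
    (h3 : S 3 = !![0, h, 0; h, 0, 0; 0, 0, 0]) :
    (∀ r : ℝ, (Matrix.det (∑ l, ((X : ℝ[X]) ^ d l) • (S l).map C)).IsRoot r →
        0 ≤ (∑ l, r ^ d l • S l).adjugate 0 0 * (∑ l, r ^ d l • S l).adjugate 1 1) ∧
    (∀ xs : List ℝ, xs.Pairwise (· < ·) → (∀ x ∈ xs, 0 < x) → (∀ x ∈ xs, (∑ l, x ^ d l • S l).adjugate 0 0 ≠ 0) →
        sgnChanges (xs.map fun t => (∑ l, t ^ d l • S l).adjugate 0 0) ≤ 5) ∧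
    (∀ xs : List ℝ, xs.Pairwise (· < ·) → (∀ x ∈ xs, 0 < x) → (∀ x ∈ xs, (∑ l, x ^ d l • S l).adjugate 1 1 ≠ 0) →
        sgnChanges (xs.map fun t => (∑ l, t ^ d l • S l).adjugate 1 1) ≤ 5) := by
  refine ⟨fun r hr => isoMinors_mul_nonneg_at_root d S hS hr, fun xs hs hp hn => ?_, fun xs hs hp hn => ?_⟩
  · exact sgnChanges_isoMinor_le_five d S 0 (by rw [h3]; exact submatrix_succAbove_zero_hyperbolic h) xs hs hp hn
  · exact sgnChanges_isoMinor_le_five d S 1 (by rw [h3]; exact submatrix_succAbove_one_hyperbolic h) xs hs hp hn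

end Summit.ValiantsHypothesis.ValiantsHypothesis.Theorems.LacunarySymmetroidMatrixDescartes.Census
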